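import Mathlib
import HarnessLib
import Summits.ValiantsHypothesis.ValiantsHypothesis.Theorems.LacunarySymmetroidMatrixDescartesProductPlusOneFewPullers

/-!
# ValiantsHypothesis / LacunarySymmetroid — crux `MatrixDescartes` (stmt-ValiantsHypothesis-18050, V1),
# LINE (A) «product_plus_one», floor `OneChangeFloorK3`: the few-pullers law WITH ONE-SIGNED ROWS (upper-signed companies, every ratio)

Extension of ✓ `…ProductPlusOneFewPullers` to the UPPER-SIGNED companies of ✓ `…ABWindow` (rows incoherent `(+,−,−)` OR one-signed `(+,+,+)`,
any signs): a one-signed row never vanishes, has `Ψ_j > 0`, `a₂/g ≤ Ψ_j/(qZ)` and `x^pΨ_j > 0` (`oneSigned_facts`), so it joins the positive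
class `P` of the Cauchy–Schwarz estimate without contributing to the riser mass.  With `R` = switched incoherent rows, `U` = unswitched incoherent
rows, `P` = all other rows (`|P| + |U| = m`), at a zero of `Ψ`:  `|P||U|·x·Ψ′ ≤ M·((q−p)|P||U| − m·x^p M)` and `x^p M > p|R|`, hence

* ★★ `psi_deriv_neg_at_zero_of_fewPullers_oneSigned` — `(q−p)·|P|·|U| ≤ p·|R|·m` ⇒ `Ψ′ < 0` at the zero;
* ★★ `X_mul_derivative_no_two_zeros_of_fewPullers_oneSigned`, `euler_window_roots_le_one_of_fewPullers_oneSigned` — on a zero-free window of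
  an upper-signed company on ANY support with that inequality at every point, `eulerNumerator d a 0` has AT MOST ONE root.

(For `U = ∅` — every incoherent row switched — there is no zero at all; the law is about windows where pullers remain but the risers outweigh
`(r−1)·|P||U|/m`.)  HONEST FRAMING: a cell of the research floor; NOT `OneChangeFloorK3` / the stubs / `MatrixDescartes`; `VP ≠ VNP` is NOT
proved.  No definitions, no named facts; Mathlib + the lane files.
-/

set_option linter.dupNamespace false

namespace Summit.ValiantsHypothesis.ValiantsHypothesis.Theorems.LacunarySymmetroidMatrixDescartes

namespace ProductPlusOne

open Polynomial Finset
open scoped BigOperators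

/-- **One-signed facts** (`a b > 0`, `a c > 0`, `x > 0`): the row does not vanish, `Ψ_j > 0`, `c_j/g_j ≤ Ψ_j/(q·x^{k+1})`, `x^{e+1}Ψ_j > 0`.
[this file's lemma] -/
theorem oneSigned_facts (a b c : ℝ) (e k : ℕ) {x : ℝ} (hx : 0 < x) (hab : 0 < a * b) (hac : 0 < a * c) :
    a + b * x ^ (e + 1) + c * x ^ (e + k + 2) ≠ 0 ∧
    0 < a * (a + b * x ^ (e + 1) + c * x ^ (e + k + 2)) ∧
    0 < ((e + 1 : ℝ) * b + (e + k + 2 : ℝ) * c * x ^ (k + 1)) / (a + b * x ^ (e + 1) + c * x ^ (e + k + 2)) ∧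
    c / (a + b * x ^ (e + 1) + c * x ^ (e + k + 2))
      ≤ ((e + 1 : ℝ) * b + (e + k + 2 : ℝ) * c * x ^ (k + 1)) / (a + b * x ^ (e + 1) + c * x ^ (e + k + 2))
        / ((e + k + 2 : ℝ) * x ^ (k + 1)) := by
  set g := a + b * x ^ (e + 1) + c * x ^ (e + k + 2) with hgdef
  have hZ : 0 < x ^ (k + 1) := pow_pos hx _
  have hX : 0 < x ^ (e + 1) := pow_pos hx _
  have hY : 0 < x ^ (e + k + 2) := pow_pos hx _
  have hq : (0 : ℝ) < (e + k + 2 : ℝ) := by positivity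
  rcases lt_or_gt_of_ne (show a ≠ 0 by rintro rfl; rw [zero_mul] at hac; exact lt_irrefl 0 hac) with ha | ha
  · have hb : b < 0 := by nlinarith
    have hc : c < 0 := by nlinarith
    have hg : g < 0 := by
      have h1 : b * x ^ (e + 1) < 0 := mul_neg_of_neg_of_pos hb hX
      have h2 : c * x ^ (e + k + 2) < 0 := mul_neg_of_neg_of_pos hc hY
      rw [hgdef]; linarith
    have hN : (e + 1 : ℝ) * b + (e + k + 2 : ℝ) * c * x ^ (k + 1) < 0 := by
      have : (e + k + 2 : ℝ) * c * x ^ (k + 1) < 0 := mul_neg_of_neg_of_pos (mul_neg_of_pos_of_neg hq hc) hZ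
      have : (e + 1 : ℝ) * b < 0 := mul_neg_of_pos_of_neg (by positivity) hb
      linarith
    refine ⟨hg.ne, mul_pos_of_neg_of_neg ha hg, div_pos_of_neg_of_neg hN hg, ?_⟩
    refine sub_nonneg.mp ?_
    have e1 : ((e + 1 : ℝ) * b + (e + k + 2 : ℝ) * c * x ^ (k + 1)) / g / ((e + k + 2 : ℝ) * x ^ (k + 1)) - c / g
        = (e + 1 : ℝ) * b / (g * ((e + k + 2 : ℝ) * x ^ (k + 1))) := by
      field_simp
      ring
    rw [e1]
    exact (div_pos_of_neg_of_neg (mul_neg_of_pos_of_neg (by positivity) hb)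
      (mul_neg_of_neg_of_pos hg (mul_pos hq hZ))).le
  · have hb : 0 < b := by nlinarith
    have hc : 0 < c := by nlinarith
    have hg : 0 < g := by rw [hgdef]; positivity
    have hN : 0 < (e + 1 : ℝ) * b + (e + k + 2 : ℝ) * c * x ^ (k + 1) := by positivity
    refine ⟨hg.ne', mul_pos ha hg, div_pos hN hg, ?_⟩
    refine sub_nonneg.mp ?_
    have e1 : ((e + 1 : ℝ) * b + (e + k + 2 : ℝ) * c * x ^ (k + 1)) / g / ((e + k + 2 : ℝ) * x ^ (k + 1)) - c / g
        = (e + 1 : ℝ) * b / (g * ((e + k + 2 : ℝ) * x ^ (k + 1))) := by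
      field_simp
      ring
    rw [e1]
    exact (div_pos (by positivity) (mul_pos hg (mul_pos hq hZ))).le

/-- ★★ **FEW PULLERS WITH ONE-SIGNED ROWS ⇒ DOWN-CROSSING.**  Upper-signed company (every row incoherent `a b < 0 ∧ a c < 0` or one-signed
`a b > 0 ∧ a c > 0`), `m ≥ 1`, `x > 0`, no row vanishing, `Ψ(x) = 0`; `U` = unswitched incoherent rows, `R` = switched (incoherent) rows,
`P` = the other rows (`|P| = m − |U|`).  If `(k+1)·|P|·|U| ≤ (e+1)·|R|·m` then `Ψ′(x) < 0`. [this file's theorem] -/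
theorem psi_deriv_neg_at_zero_of_fewPullers_oneSigned {m : ℕ} (hm : 0 < m) (a b c : Fin m → ℝ) (e k : ℕ) {x : ℝ} (hx : 0 < x)
    (hg : ∀ j, a j + b j * x ^ (e + 1) + c j * x ^ (e + k + 2) ≠ 0)
    (hcls : ∀ j, (a j * b j < 0 ∧ a j * c j < 0) ∨ (0 < a j * b j ∧ 0 < a j * c j))
    (hfew : ((k : ℝ) + 1)
        * ((Finset.univ.filter (fun j => ¬ (a j * b j < 0 ∧ 0 < a j * (a j + b j * x ^ (e + 1) + c j * x ^ (e + k + 2))))).card : ℝ)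
        * ((Finset.univ.filter (fun j => a j * b j < 0 ∧ 0 < a j * (a j + b j * x ^ (e + 1) + c j * x ^ (e + k + 2)))).card : ℝ)
      ≤ ((e : ℝ) + 1) * ((Finset.univ.filter (fun j => a j * (a j + b j * x ^ (e + 1) + c j * x ^ (e + k + 2)) < 0)).card : ℝ) * m)
    (hzero : (∑ j, ((e + 1 : ℝ) * b j + (e + k + 2 : ℝ) * c j * x ^ (k + 1)) / (a j + b j * x ^ (e + 1) + c j * x ^ (e + k + 2))) = 0) :
    (∑ j, ((((e + k + 2 : ℝ) * c j * ((k + 1 : ℝ) * x ^ k)) * (a j + b j * x ^ (e + 1) + c j * x ^ (e + k + 2))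
        - ((e + 1 : ℝ) * b j + (e + k + 2 : ℝ) * c j * x ^ (k + 1))
          * (b j * ((e + 1 : ℝ) * x ^ e) + c j * ((e + k + 2 : ℝ) * x ^ (e + k + 1))))
        / (a j + b j * x ^ (e + 1) + c j * x ^ (e + k + 2)) ^ 2)) < 0 := by
  classical
  set G : Fin m → ℝ := fun j => a j + b j * x ^ (e + 1) + c j * x ^ (e + k + 2) with hG
  set ψ : Fin m → ℝ := fun j => ((e + 1 : ℝ) * b j + (e + k + 2 : ℝ) * c j * x ^ (k + 1)) / G j with hψ
  set U := Finset.univ.filter (fun j => a j * b j < 0 ∧ 0 < a j * G j) with hU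
  set P := Finset.univ.filter (fun j => ¬ (a j * b j < 0 ∧ 0 < a j * G j)) with hP
  set R := Finset.univ.filter (fun j => a j * G j < 0) with hR
  have hZ : 0 < x ^ (k + 1) := pow_pos hx _
  have hX : 0 < x ^ (e + 1) := pow_pos hx _
  have hq : (0 : ℝ) < (e + k + 2 : ℝ) := by positivity
  -- per-row facts: `P`-rows are risers or one-signed
  have hPfacts : ∀ j ∈ P, 0 < ψ j ∧ c j / G j ≤ ψ j / ((e + k + 2 : ℝ) * x ^ (k + 1)) ∧ 0 < x ^ (e + 1) * ψ j := by
    intro j hj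
    rw [hP, mem_filter] at hj
    rcases hcls j with ⟨hab, hac⟩ | ⟨hab, hac⟩
    · -- incoherent, not an unswitched one ⇒ switched
      have hne : a j * G j ≠ 0 := mul_ne_zero (by
        intro h0; rw [h0, zero_mul] at hac; exact lt_irrefl 0 hac) (hg j)
      have hsw : a j * G j < 0 := by
        rcases lt_or_gt_of_ne hne with h | h
        · exact h
        · exact absurd ⟨hab, h⟩ hj.2
      have h := riser_facts (a j) (b j) (c j) e k hx hab hac hsw
      refine ⟨h.1, h.2.1, ?_⟩
      have hp : (0 : ℝ) < (e : ℝ) + 1 := by positivity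
      linarith [h.2.2]
    · have h := oneSigned_facts (a j) (b j) (c j) e k hx hab hac
      exact ⟨h.2.2.1, h.2.2.2, mul_pos hX h.2.2.1⟩
  have hRfacts : ∀ j ∈ R, (e + 1 : ℝ) < x ^ (e + 1) * ψ j := by
    intro j hj
    rw [hR, mem_filter] at hj
    rcases hcls j with ⟨hab, hac⟩ | ⟨hab, hac⟩
    · exact (riser_facts (a j) (b j) (c j) e k hx hab hac hj.2).2.2
    · exact absurd hj.2 (not_lt.mpr (oneSigned_facts (a j) (b j) (c j) e k hx hab hac).2.1.le)
  have hRsubP : R ⊆ P := by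
    intro j hj
    rw [hR, mem_filter] at hj
    rw [hP, mem_filter]
    exact ⟨mem_univ _, fun h => absurd hj.2 (not_lt.mpr h.2.le)⟩
  have hUfacts : ∀ j ∈ U, ψ j < 0 ∧ c j / G j < 0 := by
    intro j hj
    rw [hU, mem_filter] at hj
    have hac : a j * c j < 0 := by
      rcases hcls j with ⟨_, hac⟩ | ⟨hab, _⟩
      · exact hac
      · exact absurd hj.2.1 (not_lt.mpr hab.le)
    exact puller_facts (a j) (b j) (c j) e k hx hj.2.1 hac hj.2.2
  have hsplit : ∀ f : Fin m → ℝ, ∑ j, f j = ∑ j ∈ U, f j + ∑ j ∈ P, f j := by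
    intro f
    rw [hU, hP]
    exact (Finset.sum_filter_add_sum_filter_not _ _ _).symm
  set M := ∑ j ∈ P, ψ j with hM
  have hUsum : ∑ j ∈ U, ψ j = -M := by
    have h := hsplit ψ
    rw [hzero] at h
    linarith
  have hPne : P.Nonempty := by
    by_contra hPe
    rw [Finset.not_nonempty_iff_eq_empty] at hPe
    have hM0 : M = 0 := by rw [hM, hPe, Finset.sum_empty]
    have hUuniv : U = Finset.univ := by
      rw [hU, Finset.filter_eq_self]
      intro j _
      by_contra hj
      have : j ∈ P := by rw [hP, mem_filter]; exact ⟨mem_univ _, hj⟩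
      rw [hPe] at this; exact absurd this (Finset.notMem_empty _)
    have hneg : ∑ j ∈ U, ψ j < 0 := by
      rw [hUuniv]
      exact Finset.sum_neg (fun j hj => (hUfacts j (hUuniv ▸ hj)).1) ⟨⟨0, hm⟩, mem_univ _⟩
    rw [hUsum, hM0, neg_zero] at hneg
    exact lt_irrefl 0 hneg
  have hMpos : 0 < M := Finset.sum_pos (fun j hj => (hPfacts j hj).1) hPne
  have hUne : U.Nonempty := by
    by_contra hUe
    rw [Finset.not_nonempty_iff_eq_empty] at hUe
    have : ∑ j ∈ U, ψ j = 0 := by rw [hUe, Finset.sum_empty]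
    rw [hUsum] at this
    linarith
  have hρ : (0 : ℝ) < P.card := by exact_mod_cast hPne.card_pos
  have hυ : (0 : ℝ) < U.card := by exact_mod_cast hUne.card_pos
  have hD : (∑ j, ((((e + k + 2 : ℝ) * c j * ((k + 1 : ℝ) * x ^ k)) * (a j + b j * x ^ (e + 1) + c j * x ^ (e + k + 2))
        - ((e + 1 : ℝ) * b j + (e + k + 2 : ℝ) * c j * x ^ (k + 1))
          * (b j * ((e + 1 : ℝ) * x ^ e) + c j * ((e + k + 2 : ℝ) * x ^ (e + k + 1))))
        / (a j + b j * x ^ (e + 1) + c j * x ^ (e + k + 2)) ^ 2))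
      = (e + k + 2 : ℝ) * (k + 1 : ℝ) * x ^ k * (∑ j, c j / G j) - x ^ e * ∑ j, ψ j ^ 2 := by
    rw [Finset.mul_sum, Finset.mul_sum, ← Finset.sum_sub_distrib]
    exact Finset.sum_congr rfl (fun j _ => psi_term_deriv_eq (a j) (b j) (c j) e k (hg j))
  rw [hD]
  have hA : ∑ j, c j / G j ≤ M / ((e + k + 2 : ℝ) * x ^ (k + 1)) := by
    rw [hsplit (fun j => c j / G j), hM, Finset.sum_div]
    have h1 : ∑ j ∈ U, c j / G j ≤ 0 := Finset.sum_nonpos (fun j hj => (hUfacts j hj).2.le)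
    have h2 : ∑ j ∈ P, c j / G j ≤ ∑ j ∈ P, ψ j / ((e + k + 2 : ℝ) * x ^ (k + 1)) :=
      Finset.sum_le_sum (fun j hj => (hPfacts j hj).2.1)
    linarith
  have hSP : M ^ 2 ≤ (P.card : ℝ) * ∑ j ∈ P, ψ j ^ 2 := sq_sum_le_card_mul_sum_sq
  have hSU : M ^ 2 ≤ (U.card : ℝ) * ∑ j ∈ U, ψ j ^ 2 := by
    have h := sq_sum_le_card_mul_sum_sq (s := U) (f := ψ)
    rw [hUsum, neg_sq] at h
    exact h
  have hS : ∑ j, ψ j ^ 2 = ∑ j ∈ U, ψ j ^ 2 + ∑ j ∈ P, ψ j ^ 2 := hsplit (fun j => ψ j ^ 2)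
  -- the riser mass: `x^{e+1} M ≥ Σ_R x^{e+1} ψ_j > (e+1)|R|` (terms of `P \ R` are positive)
  have hXM : (e + 1 : ℝ) * R.card ≤ x ^ (e + 1) * M ∧ ((R.card : ℝ) = 0 → 0 < x ^ (e + 1) * M) := by
    have h1 : ∑ j ∈ R, x ^ (e + 1) * ψ j ≤ ∑ j ∈ P, x ^ (e + 1) * ψ j :=
      Finset.sum_le_sum_of_subset_of_nonneg hRsubP (fun j hj _ => (hPfacts j hj).2.2.le)
    have h2 : (e + 1 : ℝ) * R.card ≤ ∑ j ∈ R, x ^ (e + 1) * ψ j := by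
      calc (e + 1 : ℝ) * R.card = ∑ _j ∈ R, (e + 1 : ℝ) := by rw [Finset.sum_const, nsmul_eq_mul, mul_comm]
        _ ≤ ∑ j ∈ R, x ^ (e + 1) * ψ j := Finset.sum_le_sum (fun j hj => (hRfacts j hj).le)
    refine ⟨?_, fun _ => mul_pos hX hMpos⟩
    rw [hM, Finset.mul_sum]
    exact h2.trans h1
  have hcardm : (U.card : ℝ) + P.card = m := by
    have h := Finset.card_filter_add_card_filter_not (s := (Finset.univ : Finset (Fin m))) (fun j => a j * b j < 0 ∧ 0 < a j * G j)
    rw [Finset.card_univ, Fintype.card_fin] at h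
    rw [hU, hP]
    exact_mod_cast h
  have hfew' : ((k : ℝ) + 1) * P.card * U.card ≤ ((e : ℝ) + 1) * R.card * m := hfew
  have hxk1 : x ^ k * x = x ^ (k + 1) := by rw [pow_succ]
  have hxe1 : x ^ e * x = x ^ (e + 1) := by rw [pow_succ]
  have hstepA : x * ((e + k + 2 : ℝ) * (k + 1 : ℝ) * x ^ k * (∑ j, c j / G j)) ≤ (k + 1 : ℝ) * M := by
    have h1 : x * ((e + k + 2 : ℝ) * (k + 1 : ℝ) * x ^ k * (∑ j, c j / G j))
        ≤ x * ((e + k + 2 : ℝ) * (k + 1 : ℝ) * x ^ k * (M / ((e + k + 2 : ℝ) * x ^ (k + 1)))) :=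
      mul_le_mul_of_nonneg_left (mul_le_mul_of_nonneg_left hA (by positivity)) hx.le
    have h2 : x * ((e + k + 2 : ℝ) * (k + 1 : ℝ) * x ^ k * (M / ((e + k + 2 : ℝ) * x ^ (k + 1)))) = (k + 1 : ℝ) * M := by
      rw [← hxk1]
      field_simp
    linarith
  set S := ∑ j, ψ j ^ 2 with hSdef
  have hb1 : (U.card : ℝ) * M ^ 2 + P.card * M ^ 2 ≤ (P.card : ℝ) * U.card * S := by
    have e1 : (P.card : ℝ) * U.card * S = U.card * (P.card * ∑ j ∈ P, ψ j ^ 2) + P.card * (U.card * ∑ j ∈ U, ψ j ^ 2) := by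
      rw [hS]; ring
    rw [e1]
    exact add_le_add (mul_le_mul_of_nonneg_left hSP hυ.le) (mul_le_mul_of_nonneg_left hSU hρ.le)
  have hm' : (0 : ℝ) < m := by exact_mod_cast hm
  -- strict comparison `(k+1)|P||U| M < x^{e+1} M m · M`
  have hkey : ((k : ℝ) + 1) * P.card * U.card * M < x ^ (e + 1) * M * m * M := by
    have h7 : ((k : ℝ) + 1) * P.card * U.card * M ≤ ((e : ℝ) + 1) * R.card * m * M :=
      mul_le_mul_of_nonneg_right hfew' hMpos.le
    rcases eq_or_lt_of_le (show (0 : ℝ) ≤ R.card by positivity) with h0 | hRpos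
    · -- no risers: then the hypothesis forces `|P||U| = 0`, contradiction with both nonempty — so this branch is vacuous
      have : ((k : ℝ) + 1) * P.card * U.card ≤ 0 := by
        have h := hfew'
        rw [← h0, mul_zero, zero_mul] at h
        exact h
      have hk0 : (0 : ℝ) < (k : ℝ) + 1 := by positivity
      have : (0 : ℝ) < ((k : ℝ) + 1) * P.card * U.card := mul_pos (mul_pos hk0 hρ) hυ
      linarith
    · have h6 : ((e : ℝ) + 1) * R.card * m * M < x ^ (e + 1) * M * m * M := by
        have := hXM.1
        have h8 : ((e : ℝ) + 1) * R.card * m < x ^ (e + 1) * M * m := by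
          -- strictness from one riser: `(e+1)|R| < x^{e+1} Σ_R ψ ≤ x^{e+1} M`
          have hRne : R.Nonempty := by
            rw [← Finset.card_pos]; exact_mod_cast hRpos
          have h2 : (e + 1 : ℝ) * R.card < ∑ j ∈ R, x ^ (e + 1) * ψ j := by
            calc (e + 1 : ℝ) * R.card = ∑ _j ∈ R, (e + 1 : ℝ) := by rw [Finset.sum_const, nsmul_eq_mul, mul_comm]
              _ < ∑ j ∈ R, x ^ (e + 1) * ψ j := Finset.sum_lt_sum_of_nonempty hRne (fun j hj => hRfacts j hj)
          have h1 : ∑ j ∈ R, x ^ (e + 1) * ψ j ≤ x ^ (e + 1) * M := by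
            rw [hM, Finset.mul_sum]
            exact Finset.sum_le_sum_of_subset_of_nonneg hRsubP (fun j hj _ => (hPfacts j hj).2.2.le)
          nlinarith
        exact mul_lt_mul_of_pos_right h8 hMpos
      linarith
  have h4 : x ^ (e + 1) * ((U.card : ℝ) * M ^ 2 + P.card * M ^ 2) ≤ x ^ (e + 1) * ((P.card : ℝ) * U.card * S) :=
    mul_le_mul_of_nonneg_left hb1 hX.le
  have h5 : x ^ (e + 1) * M * m * M = x ^ (e + 1) * ((U.card : ℝ) * M ^ 2 + P.card * M ^ 2) := by
    rw [← hcardm]; ring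
  have h8 : (P.card : ℝ) * U.card * ((k + 1 : ℝ) * M) < (P.card : ℝ) * U.card * (x ^ (e + 1) * S) := by
    have e7 : ((k : ℝ) + 1) * P.card * U.card * M = (P.card : ℝ) * U.card * ((k + 1 : ℝ) * M) := by ring
    have e8 : x ^ (e + 1) * ((P.card : ℝ) * U.card * S) = (P.card : ℝ) * U.card * (x ^ (e + 1) * S) := by ring
    linarith
  have hstepB : (k + 1 : ℝ) * M < x ^ (e + 1) * S := lt_of_mul_lt_mul_left h8 (mul_nonneg hρ.le hυ.le)
  have hfin : x * ((e + k + 2 : ℝ) * (k + 1 : ℝ) * x ^ k * (∑ j, c j / G j) - x ^ e * S) < 0 := by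
    have e3 : x * ((e + k + 2 : ℝ) * (k + 1 : ℝ) * x ^ k * (∑ j, c j / G j) - x ^ e * S)
        = x * ((e + k + 2 : ℝ) * (k + 1 : ℝ) * x ^ k * (∑ j, c j / G j)) - x ^ (e + 1) * S := by
      rw [← hxe1]; ring
    rw [e3]
    linarith
  by_contra hcon
  push Not at hcon
  exact absurd hfin (not_lt.mpr (mul_nonneg hx.le hcon))

/-! ### The window law -/

/-- ★★ **Window law with one-signed rows (normalised chart).**  Upper-signed company, `m ≥ 1`; on `[w₁,w₂] ⊂ (0,∞)` no row vanishes and at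
every point `(k+1)·|P|·|U| ≤ (e+1)·|R|·m`.  Then `X·P′` has no two zeros `w₁, w₂`. [this file's theorem] -/
theorem X_mul_derivative_no_two_zeros_of_fewPullers_oneSigned {m : ℕ} (hm : 0 < m) (a b c : Fin m → ℝ) (e k : ℕ) {w₁ w₂ : ℝ}
    (hw₁ : 0 < w₁) (hw : w₁ < w₂)
    (hcls : ∀ j, (a j * b j < 0 ∧ a j * c j < 0) ∨ (0 < a j * b j ∧ 0 < a j * c j))
    (hfree : ∀ t ∈ Set.Icc w₁ w₂, ∀ j, a j + b j * t ^ (e + 1) + c j * t ^ (e + k + 2) ≠ 0)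
    (hfew : ∀ t ∈ Set.Icc w₁ w₂, ((k : ℝ) + 1)
        * ((Finset.univ.filter (fun j => ¬ (a j * b j < 0 ∧ 0 < a j * (a j + b j * t ^ (e + 1) + c j * t ^ (e + k + 2))))).card : ℝ)
        * ((Finset.univ.filter (fun j => a j * b j < 0 ∧ 0 < a j * (a j + b j * t ^ (e + 1) + c j * t ^ (e + k + 2)))).card : ℝ)
      ≤ ((e : ℝ) + 1) * ((Finset.univ.filter (fun j => a j * (a j + b j * t ^ (e + 1) + c j * t ^ (e + k + 2)) < 0)).card : ℝ) * m)
    (h1 : eval w₁ (X * derivative (∏ j, (C (a j) + C (b j) * X ^ (e + 1) + C (c j) * X ^ (e + k + 2)))) = 0)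
    (h2 : eval w₂ (X * derivative (∏ j, (C (a j) + C (b j) * X ^ (e + 1) + C (c j) * X ^ (e + k + 2)))) = 0) : False := by
  set φ : ℝ → ℝ := fun y => ∑ j, ((e + 1 : ℝ) * b j + (e + k + 2 : ℝ) * c j * y ^ (k + 1))
      / (a j + b j * y ^ (e + 1) + c j * y ^ (e + k + 2)) with hφ
  set φ' : ℝ → ℝ := fun t => ∑ j, ((((e + k + 2 : ℝ) * c j * ((k + 1 : ℝ) * t ^ k)) * (a j + b j * t ^ (e + 1) + c j * t ^ (e + k + 2))
        - ((e + 1 : ℝ) * b j + (e + k + 2 : ℝ) * c j * t ^ (k + 1))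
          * (b j * ((e + 1 : ℝ) * t ^ e) + c j * ((e + k + 2 : ℝ) * t ^ (e + k + 1))))
        / (a j + b j * t ^ (e + 1) + c j * t ^ (e + k + 2)) ^ 2) with hφ'
  have hder : ∀ t ∈ Set.Icc w₁ w₂, HasDerivAt φ (φ' t) t := by
    intro t ht
    have := HasDerivAt.fun_sum (u := Finset.univ) (fun j _ => hasDerivAt_term (a j) (b j) (c j) e k (hfree t ht j))
    rw [hφ]
    exact this
  have hdown : ∀ t ∈ Set.Icc w₁ w₂, φ t = 0 → φ' t < 0 := by
    intro t ht h0
    exact psi_deriv_neg_at_zero_of_fewPullers_oneSigned hm a b c e k (hw₁.trans_le ht.1) (hfree t ht) hcls (hfew t ht) h0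
  have h01 : φ w₁ = 0 := psi_eq_zero_of_eval_X_mul_derivative a b c e k hw₁ (hfree w₁ ⟨le_rfl, hw.le⟩) h1
  have h02 : φ w₂ = 0 := psi_eq_zero_of_eval_X_mul_derivative a b c e k (hw₁.trans hw) (hfree w₂ ⟨hw.le, le_rfl⟩) h2
  exact no_two_zeros_of_deriv_neg_at_zeros hder hdown le_rfl hw le_rfl h01 h02

/-- ★★ **FEW-PULLERS WINDOW LAW WITH ONE-SIGNED ROWS** (`K = 3`, bottom coupling, ANY support `d 0 < d 1 < d 2`, any `m`; upper-signed
company: every row incoherent `a_{j0}a_{j1} < 0 ∧ a_{j0}a_{j2} < 0` or one-signed `a_{j0}a_{j1} > 0 ∧ a_{j0}a_{j2} > 0`).  On a zero-free window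
`[u,v] ⊂ (0,∞)` on which at every point `t`, with `U(t)` = unswitched incoherent rows (`a_{j0}a_{j1} < 0`, `a_{j0}f_j(t) > 0`), `P(t)` = the
other rows and `R(t)` = switched rows (`a_{j0} f_j(t) < 0`), `(d₂−d₁)·|P(t)|·|U(t)| ≤ (d₁−d₀)·|R(t)|·m`, the c-free Euler numerator
`eulerNumerator d a 0` has AT MOST ONE root. [this file's theorem] -/
theorem euler_window_roots_le_one_of_fewPullers_oneSigned {m : ℕ} (d : Fin 3 → ℕ) (h01 : d 0 < d 1) (h12 : d 1 < d 2)
    (a : Fin m → Fin 3 → ℝ) (hcls : ∀ j, (a j 0 * a j 1 < 0 ∧ a j 0 * a j 2 < 0) ∨ (0 < a j 0 * a j 1 ∧ 0 < a j 0 * a j 2))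
    {u v : ℝ} (hu : 0 < u)
    (hfree : ∀ t ∈ Set.Icc u v, ∀ j, (∑ l, C (a j l) * X ^ (d l) : ℝ[X]).eval t ≠ 0)
    (hfew : ∀ t ∈ Set.Icc u v, ((d 2 : ℝ) - d 1)
        * ((Finset.univ.filter (fun j => ¬ (a j 0 * a j 1 < 0 ∧ 0 < a j 0 * (∑ l, C (a j l) * X ^ (d l) : ℝ[X]).eval t))).card : ℝ)
        * ((Finset.univ.filter (fun j => a j 0 * a j 1 < 0 ∧ 0 < a j 0 * (∑ l, C (a j l) * X ^ (d l) : ℝ[X]).eval t)).card : ℝ)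
      ≤ ((d 1 : ℝ) - d 0) * ((Finset.univ.filter (fun j => a j 0 * (∑ l, C (a j l) * X ^ (d l) : ℝ[X]).eval t < 0)).card : ℝ) * m) :
    ((∑ j, (∑ l, C (a j l * ((d l : ℝ) - d 0)) * X ^ (d l)) * ∏ i ∈ Finset.univ.erase j, (∑ l, C (a i l) * X ^ (d l))
        : ℝ[X]).roots.toFinset.filter (fun t => u ≤ t ∧ t ≤ v)).card ≤ 1 := by
  classical
  rcases Nat.eq_zero_or_pos m with hm | hm
  · subst hm
    simp only [Finset.univ_eq_empty, Finset.sum_empty, roots_zero, Multiset.toFinset_zero, Finset.filter_empty,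
      Finset.card_empty]
    exact Nat.zero_le _
  obtain ⟨e, he⟩ : ∃ e, d 1 = d 0 + e + 1 := ⟨d 1 - d 0 - 1, by omega⟩
  obtain ⟨k, hk⟩ : ∃ k, d 2 = d 0 + e + k + 2 := ⟨d 2 - d 1 - 1, by omega⟩
  have hp : ((d 1 : ℝ) - d 0) = (e + 1 : ℝ) := by rw [he]; push_cast; ring
  have hqp : ((d 2 : ℝ) - d 1) = (k + 1 : ℝ) := by rw [hk, he]; push_cast; ring
  rw [eulerNumerator_eq d e k he hk a 0, sub_self, mul_zero, map_zero, zero_mul, sub_zero]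
  set E : ℝ[X] := X * derivative (∏ j, (C (a j 0) + C (a j 1) * X ^ (e + 1) + C (a j 2) * X ^ (e + k + 2))) with hE
  by_contra hgt
  push Not at hgt
  obtain ⟨z₁, hz₁, z₂, hz₂, hne⟩ := Finset.one_lt_card.mp hgt
  have hfree' : ∀ w₁ w₂ : ℝ, u ≤ w₁ → w₂ ≤ v → ∀ t ∈ Set.Icc w₁ w₂, ∀ j,
      a j 0 + a j 1 * t ^ (e + 1) + a j 2 * t ^ (e + k + 2) ≠ 0 := by
    intro w₁ w₂ hw₁ hw₂ t ht j
    have h := hfree t ⟨hw₁.trans ht.1, ht.2.trans hw₂⟩ j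
    rw [eval_row_eq_pow_mul d e k he hk (a j) t] at h
    exact right_ne_zero_of_mul h
  have hfew' : ∀ w₁ w₂ : ℝ, u ≤ w₁ → w₂ ≤ v → ∀ t ∈ Set.Icc w₁ w₂, ((k : ℝ) + 1)
        * ((Finset.univ.filter (fun j => ¬ (a j 0 * a j 1 < 0 ∧ 0 < a j 0 * (a j 0 + a j 1 * t ^ (e + 1) + a j 2 * t ^ (e + k + 2))))).card : ℝ)
        * ((Finset.univ.filter (fun j => a j 0 * a j 1 < 0 ∧ 0 < a j 0 * (a j 0 + a j 1 * t ^ (e + 1) + a j 2 * t ^ (e + k + 2)))).card : ℝ)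
      ≤ ((e : ℝ) + 1) * ((Finset.univ.filter (fun j => a j 0 * (a j 0 + a j 1 * t ^ (e + 1) + a j 2 * t ^ (e + k + 2)) < 0)).card : ℝ)
        * m := by
    intro w₁ w₂ hw₁ hw₂ t ht
    have htI : t ∈ Set.Icc u v := ⟨hw₁.trans ht.1, ht.2.trans hw₂⟩
    have ht0 : 0 < t := hu.trans_le htI.1
    have hiff : ∀ j, (0 < a j 0 * (∑ l, C (a j l) * X ^ (d l) : ℝ[X]).eval t)
        ↔ (0 < a j 0 * (a j 0 + a j 1 * t ^ (e + 1) + a j 2 * t ^ (e + k + 2))) := by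
      intro j
      rw [eval_row_eq_pow_mul d e k he hk (a j) t, mul_left_comm]
      exact ⟨fun h' => pos_of_mul_pos_right h' (pow_pos ht0 _).le, fun h' => mul_pos (pow_pos ht0 _) h'⟩
    have hsetP : Finset.univ.filter (fun j => ¬ (a j 0 * a j 1 < 0 ∧ 0 < a j 0 * (∑ l, C (a j l) * X ^ (d l) : ℝ[X]).eval t))
        = Finset.univ.filter (fun j => ¬ (a j 0 * a j 1 < 0 ∧ 0 < a j 0 * (a j 0 + a j 1 * t ^ (e + 1) + a j 2 * t ^ (e + k + 2)))) :=
      Finset.filter_congr (fun j _ => by rw [hiff j])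
    have hsetU : Finset.univ.filter (fun j => a j 0 * a j 1 < 0 ∧ 0 < a j 0 * (∑ l, C (a j l) * X ^ (d l) : ℝ[X]).eval t)
        = Finset.univ.filter (fun j => a j 0 * a j 1 < 0 ∧ 0 < a j 0 * (a j 0 + a j 1 * t ^ (e + 1) + a j 2 * t ^ (e + k + 2))) :=
      Finset.filter_congr (fun j _ => by rw [hiff j])
    have hsetR : Finset.univ.filter (fun j => a j 0 * (∑ l, C (a j l) * X ^ (d l) : ℝ[X]).eval t < 0)
        = Finset.univ.filter (fun j => a j 0 * (a j 0 + a j 1 * t ^ (e + 1) + a j 2 * t ^ (e + k + 2)) < 0) := by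
      refine Finset.filter_congr (fun j _ => ?_)
      rw [eval_row_eq_pow_mul d e k he hk (a j) t, mul_left_comm]
      exact ⟨fun h' => neg_of_mul_neg_right h' (pow_pos ht0 _).le, fun h' => mul_neg_of_pos_of_neg (pow_pos ht0 _) h'⟩
    have h := hfew t htI
    rw [hsetP, hsetU, hsetR, hp, hqp] at h
    exact h
  have hmem : ∀ z ∈ (((X : ℝ[X]) ^ (m * d 0) * E).roots.toFinset.filter (fun t => u ≤ t ∧ t ≤ v)),
      u ≤ z ∧ z ≤ v ∧ eval z E = 0 := by
    intro z hz
    rw [mem_filter, Multiset.mem_toFinset] at hz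
    by_cases h0 : (X : ℝ[X]) ^ (m * d 0) * E = 0
    · rw [h0, roots_zero] at hz
      exact absurd hz.1 (Multiset.notMem_zero _)
    · have hr := (mem_roots h0).mp hz.1
      rw [IsRoot.def, eval_mul, eval_pow, eval_X] at hr
      refine ⟨hz.2.1, hz.2.2, ?_⟩
      rcases mul_eq_zero.mp hr with h | h
      · exact absurd h (pow_ne_zero _ (hu.trans_le hz.2.1).ne')
      · exact h
  have hcls' : ∀ j, (a j 0 * a j 1 < 0 ∧ a j 0 * a j 2 < 0) ∨ (0 < a j 0 * a j 1 ∧ 0 < a j 0 * a j 2) := hcls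
  obtain ⟨hu₁, hv₁, hE₁⟩ := hmem z₁ hz₁
  obtain ⟨hu₂, hv₂, hE₂⟩ := hmem z₂ hz₂
  rcases lt_or_gt_of_ne hne with hlt | hlt
  · exact X_mul_derivative_no_two_zeros_of_fewPullers_oneSigned hm (fun j => a j 0) (fun j => a j 1) (fun j => a j 2) e k
      (hu.trans_le hu₁) hlt hcls' (hfree' z₁ z₂ hu₁ hv₂) (hfew' z₁ z₂ hu₁ hv₂) hE₁ hE₂
  · exact X_mul_derivative_no_two_zeros_of_fewPullers_oneSigned hm (fun j => a j 0) (fun j => a j 1) (fun j => a j 2) e k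
      (hu.trans_le hu₂) hlt hcls' (hfree' z₂ z₁ hu₂ hv₁) (hfew' z₂ z₁ hu₂ hv₁) hE₂ hE₁

end ProductPlusOne

end Summit.ValiantsHypothesis.ValiantsHypothesis.Theorems.LacunarySymmetroidMatrixDescartes
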